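import Summits.BirchSwinnertonDyer.Rank1Residual.X9.LeafDischargeKolyvaginCebotarev
import HarnessLib

/-!
# Class X9: the DISCHARGE INTERFACE for (C4) at level `p^M` over the Heegner field — a scalar
# `≢ 1 (mod p)` in `ρ_{E,p^M}(Γ_K)` and the no-fixed-vector (Sah) shape for
# `H¹(K(E[p^M])/K, E[p^M]) = 0`

Print-tier cell `bsd-print-x9` (D-0131 (2), key `x9`), typer seat ty2, file G of the discharge
interface (sequel of F = `X9/LeafDischargeKolyvaginCebotarev`, which it imports). Theorems only: no
definition, no new named fact (D-0014 / D-0026); nothing here is a class theorem.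

Jetchev 2008 §6 / McCallum 1991 §4 use Hypothesis (∗) (`ρ_{E,p}` onto) a second time, for
`H¹(K(E[p^M])/K, E[p^M]) = 0`; at irreducible image this is Sah's lemma applied to a central
element of `Gal(K(E[p^M])/K)` acting on `E[p^M]` as a scalar `≢ 1 (mod p)` (Cha 2005 Thm. 7;
Matar–Nekovář 2019 Prop. 6.4 (C4), Prop. 6.5). On an X9 Heegner frame (`ClassX9 W p`, `K` imaginary
quadratic, Heegner hypothesis for `N_E`, `p` split) file F gives (Z): `z ∈ Γ_K` acting on `E(K̄)[p]`
as a scalar `a ≢ 1`. This file lifts it to level `p^M` and puts it in the shape the tree's Sah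
lemmas consume:

* `ClassX9.kolyvaginImage_scalar_unit_of_heegner` — the scalar of (Z) is a unit mod `p` (`z` is an
  automorphism of `E[p] ≠ 0`, `#E[p] = p²`);
* `ClassX9.kolyvaginImage_scalar_pow_of_heegner` — `z^{p^{M−1}}` acts on `E(K̄)[p^M]` as
  `a^{p^{M−1}}`, again `≢ 0, 1 (mod p)` (tree `JetchevIrreducibleCebotarev.smul_pow_eq_smul_geomTorsion_pow`,
  Fermat `prime_dvd_pow_prime_pow_sub`);
* `eq_zero_of_smul_eq_of_prime_pow` — a scalar `a ≢ 1 (mod p)` has no non-zero fixed vector on a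
  `p^M`-torsion group (level-`p^M` form of the tree's `eq_zero_of_smul_eq_of_prime`);
* `ClassX9.exists_homothety_noFixedVector_baseChange_of_heegner` (level `p`) and
  `ClassX9.exists_homothety_pow_noFixedVector_of_heegner` (level `p^M`) — the hypothesis `hz` of the
  tree's `galoisCohomology.res_one_injective_of_forall_fixed_eq_zero` /
  `bijective_quotientInvariants_sub_self` for the Galois module `(W⁄K).torsionGaloisModule n`
  (`n = p`, `p^M`): some `z ∈ Γ_K` acts as an integer scalar with no non-zero fixed vector. File E
  (`ClassX9.exists_homothety_noFixedVector`) is the level-`p` shape over `ℚ`.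

## References

* [Cha2005] B. Cha, *Vanishing of some cohomology classes of Shimura varieties…*, J. Number Theory
  111 (2005), Thm. 7 (p. 158).
* [MatarNekovar2019] A. Matar, J. Nekovář, JTNB 31 (2019), Prop. 6.4 (C4), Prop. 6.5 (p. 498).
* [Sah1968] C.-H. Sah, *Automorphisms of finite groups*, J. Algebra 10 (1968), Prop. 2.7 (b).
* [GrossLMS1991] B. H. Gross, LMS LN 153 (1991), Prop. 9.1.
* [Serre1972] J.-P. Serre, Invent. Math. 15 (1972), §2.4 Prop. 15, §2.6.
-/

set_option autoImplicit false

noncomputable section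

open scoped Classical Pointwise

universe u

open WeierstrassCurve NumberField IsDedekindDomain Field
  Literature.NumberTheory.GaloisRepresentations Literature.NumberTheory.EllipticCurves
  Summit.BirchSwinnertonDyer.BirchSwinnertonDyer.Theorems.JetchevIrreducibleCebotarev

namespace Literature.NumberTheory.EllipticCurves.Rank1Residual

/-! ### 1. A scalar `≢ 1 (mod p)` on a `p^M`-torsion group has no non-zero fixed vector -/

/-- **A scalar `a` with `q ∤ a − 1` has no non-zero fixed vector on a `q^M`-torsion element**
(`(a − 1) m = 0` and `q^M m = 0` force `ord m = 1`). Level-`q^M` form of the tree's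
`eq_zero_of_smul_eq_of_prime`. [cite: Sah1968, Prop. 2.7 (b)] -/
theorem eq_zero_of_smul_eq_of_prime_pow {A : Type*} [AddCommGroup A] {q : ℕ} (hq : q.Prime)
    (M : ℕ) {m : A} (hqm : q ^ M • m = 0) {a : ℤ} (ha : ¬ (q : ℤ) ∣ a - 1) (ham : a • m = m) :
    m = 0 := by
  have h1 : (a - 1) • m = 0 := by rw [sub_smul, one_smul, ham, sub_self]
  have hord : addOrderOf m ∣ q ^ M := addOrderOf_dvd_of_nsmul_eq_zero hqm
  obtain ⟨k, -, hk⟩ := (Nat.dvd_prime_pow hq).mp hord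
  rcases k with _ | k
  · exact AddMonoid.addOrderOf_eq_one_iff.mp (by rw [hk, pow_zero])
  · exfalso
    apply ha
    have h2 : (addOrderOf m : ℤ) ∣ a - 1 := addOrderOf_dvd_iff_zsmul_eq_zero.mpr h1
    rw [hk] at h2
    have h3 : (q : ℤ) ^ (k + 1) ∣ a - 1 := by exact_mod_cast h2
    exact (dvd_pow_self (q : ℤ) (Nat.succ_ne_zero k)).trans h3

/-! ### 2. On class X9: the lifted scalar and the Sah shapes over `K` -/

section X9

variable {W : WeierstrassCurve ℚ} [W.IsElliptic] [W.IsGloballyMinimal] {p : ℕ} [Fact p.Prime]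

/-- **(Z) on X9 Heegner frames, with the scalar a unit**: some `z ∈ Γ_K` acts on `E(K̄)[p]` as an
integer scalar `a` with `p ∤ a` and `p ∤ a − 1` (`p ∤ a` because `z` is an automorphism of
`E[p] ≠ 0`, `#E[p] = p²`). The unit condition is what the level-raising lemma
`JetchevIrreducibleCebotarev.smul_pow_eq_smul_geomTorsion_pow` consumes.
[cite: Serre1972, §2.4 Prop. 15 and §2.6] [cite: Sah1968, Prop. 2.7 (b)] -/
theorem ClassX9.kolyvaginImage_scalar_unit_of_heegner (h : ClassX9 W p) {K : Type u} [Field K]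
    [NumberField K] (hK : IsImaginaryQuadratic K)
    (hHN : SatisfiesHeegnerHypothesis (W.conductorNorm ℤ) K) (hHp : SatisfiesHeegnerHypothesis p K) :
    ∃ (z : absoluteGaloisGroup K) (a : ℤ), ¬ (p : ℤ) ∣ a ∧ ¬ (p : ℤ) ∣ a - 1 ∧
      ∀ P : geomTorsion (W.baseChange K) p, z • P = a • P := by
  have hp : p.Prime := Fact.out
  obtain ⟨z, a, ha1, hz⟩ := h.kolyvaginImage_scalar_of_heegner hK hHN hHp
  refine ⟨z, a, ?_, ha1, hz⟩
  rintro ⟨c, hc⟩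
  -- then `z`, an automorphism, would kill `E(K̄)[p] ≠ 0`
  have hkill : ∀ P : geomTorsion (W.baseChange K) p, (p : ℤ) • P = 0 := fun P ↦ Subtype.ext (by
    rw [AddSubgroupClass.coe_zsmul, ZeroMemClass.coe_zero]
    exact (mem_geomTorsion_iff (W.baseChange K) _ _).mp P.2)
  have hall : ∀ P : geomTorsion (W.baseChange K) p, P = 0 := fun P ↦ by
    have h1 : z • P = 0 := by rw [hz, hc, mul_comm, mul_smul, hkill, smul_zero]
    calc P = z⁻¹ • z • P := (inv_smul_smul z P).symm
      _ = 0 := by rw [h1, smul_zero]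
  haveI : Subsingleton (geomTorsion (W.baseChange K) p) := ⟨fun P Q ↦ by rw [hall P, hall Q]⟩
  have hcard : Nat.card (geomTorsion (W.baseChange K) p) = p ^ 2 :=
    card_torsionPoints_eq_sq_holds (W.baseChange K) (AlgebraicClosure K) (n := p)
      (by exact_mod_cast hp.ne_zero)
  rw [Nat.card_of_subsingleton (0 : geomTorsion (W.baseChange K) p)] at hcard
  have h1lt : 1 < p ^ 2 := Nat.one_lt_pow two_ne_zero hp.one_lt
  omega

/-- **(C4) at level `p^M` on X9 Heegner frames: a scalar `≢ 1 (mod p)` in `ρ_{E,p^M}(Γ_K)`** —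
`z^{p^{M−1}}` acts on `E(K̄)[p^M]` as `a^{p^{M−1}}` (tree `smul_pow_eq_smul_geomTorsion_pow`:
`(a + pX)^{p^{M−1}} ≡ a^{p^{M−1}} (mod p^M)`), and `a^{p^{M−1}} ≡ a ≢ 0, 1 (mod p)` (Fermat,
`prime_dvd_pow_prime_pow_sub`). This is the central non-trivial homothety of
`Gal(K(E[p^M])/K)` behind `H¹(K(E[p^M])/K, E[p^M]) = 0` (Cha 2005 Thm. 7; Matar–Nekovář (C4)).
[cite: Cha2005, Thm. 7 (p. 158)] [cite: MatarNekovar2019, Prop. 6.4 (C4), Prop. 6.5 (p. 498)]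
[cite: Sah1968, Prop. 2.7 (b)] -/
theorem ClassX9.kolyvaginImage_scalar_pow_of_heegner (h : ClassX9 W p) {K : Type u} [Field K]
    [NumberField K] (hK : IsImaginaryQuadratic K)
    (hHN : SatisfiesHeegnerHypothesis (W.conductorNorm ℤ) K) (hHp : SatisfiesHeegnerHypothesis p K)
    {M : ℕ} (hM : 1 ≤ M) :
    ∃ (z : absoluteGaloisGroup K) (a : ℤ), ¬ (p : ℤ) ∣ a ∧ ¬ (p : ℤ) ∣ a - 1 ∧
      ∀ P : geomTorsion (W.baseChange K) ((p ^ M : ℕ) : ℤ), z • P = a • P := by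
  have hp : p.Prime := Fact.out
  obtain ⟨z, a, ha0, ha1, hz⟩ := h.kolyvaginImage_scalar_unit_of_heegner hK hHN hHp
  have h2 := prime_dvd_pow_prime_pow_sub hp a (M - 1)
  refine ⟨z ^ p ^ (M - 1), a ^ p ^ (M - 1), fun hd ↦ ha0 ?_, fun hd ↦ ha1 ?_, fun P ↦
    smul_pow_eq_smul_geomTorsion_pow (W.baseChange K) hp hM ha0 hz P⟩
  · have : a = a ^ p ^ (M - 1) - (a ^ p ^ (M - 1) - a) := by ring
    rw [this]
    exact dvd_sub hd h2
  · have : a - 1 = (a ^ p ^ (M - 1) - 1) - (a ^ p ^ (M - 1) - a) := by ring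
    rw [this]
    exact dvd_sub hd h2

/-- **The Sah shape at level `p` over `K`, on X9 Heegner frames**: some `z ∈ Γ_K` acts on the Galois
module `E(K̄)[p]` (`(W⁄K).torsionGaloisModule p`) as an integer scalar with NO non-zero fixed vector
— the hypothesis `hz` of the tree's `galoisCohomology.res_one_injective_of_forall_fixed_eq_zero` /
`bijective_quotientInvariants_sub_self` (restriction `H¹(K, E[p]) → H¹(K(E[p]), E[p])` injective,
i.e. `H¹(K(E[p])/K, E[p]) = 0`; Gross Prop. 9.1 at irreducible image). File E has the same over `ℚ`.
[cite: GrossLMS1991, Prop. 9.1] [cite: MatarNekovar2019, Prop. 6.4 (C4), Prop. 6.5 (p. 498)]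
[cite: Sah1968, Prop. 2.7 (b)] -/
theorem ClassX9.exists_homothety_noFixedVector_baseChange_of_heegner (h : ClassX9 W p) {K : Type u}
    [Field K] [NumberField K] (hK : IsImaginaryQuadratic K)
    (hHN : SatisfiesHeegnerHypothesis (W.conductorNorm ℤ) K) (hHp : SatisfiesHeegnerHypothesis p K) :
    ∃ (z : absoluteGaloisGroup K) (a : ℤ),
      (∀ m : geomTorsion (W.baseChange K) (p : ℤ),
        (W.baseChange K).torsionGaloisModule (p : ℤ) z m = a • m) ∧
      (∀ m : geomTorsion (W.baseChange K) (p : ℤ),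
        (W.baseChange K).torsionGaloisModule (p : ℤ) z m = m → m = 0) := by
  have hp : p.Prime := Fact.out
  obtain ⟨z, a, ha1, hz⟩ := h.kolyvaginImage_scalar_of_heegner hK hHN hHp
  refine ⟨z, a, fun m ↦ by rw [WeierstrassCurve.torsionGaloisModule_apply_apply, hz m],
    fun m hm ↦ ?_⟩
  rw [WeierstrassCurve.torsionGaloisModule_apply_apply, hz m] at hm
  exact eq_zero_of_smul_eq_of_prime hp (AddSubgroup.torsionBy.nsmul m) ha1 hm

/-- **The Sah shape at level `p^M` over `K`, on X9 Heegner frames** (`M ≥ 1`): some `z ∈ Γ_K` acts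
on the Galois module `E(K̄)[p^M]` (`(W⁄K).torsionGaloisModule (p^M)`) as an integer scalar with NO
non-zero fixed vector — the input of Sah's lemma for `H¹(K(E[p^M])/K, E[p^M]) = 0` (Cha 2005
Thm. 7: the image contains a non-trivial homothety; Matar–Nekovář (C4) at level `p^M`), used in
Jetchev §6 / McCallum §4 in place of Hypothesis (∗).
[cite: Cha2005, Thm. 7 (p. 158)] [cite: MatarNekovar2019, Prop. 6.4 (C4), Prop. 6.5 (p. 498)]
[cite: Sah1968, Prop. 2.7 (b)] -/
theorem ClassX9.exists_homothety_pow_noFixedVector_of_heegner (h : ClassX9 W p) {K : Type u}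
    [Field K] [NumberField K] (hK : IsImaginaryQuadratic K)
    (hHN : SatisfiesHeegnerHypothesis (W.conductorNorm ℤ) K) (hHp : SatisfiesHeegnerHypothesis p K)
    {M : ℕ} (hM : 1 ≤ M) :
    ∃ (z : absoluteGaloisGroup K) (a : ℤ),
      (∀ m : geomTorsion (W.baseChange K) ((p ^ M : ℕ) : ℤ),
        (W.baseChange K).torsionGaloisModule ((p ^ M : ℕ) : ℤ) z m = a • m) ∧
      (∀ m : geomTorsion (W.baseChange K) ((p ^ M : ℕ) : ℤ),
        (W.baseChange K).torsionGaloisModule ((p ^ M : ℕ) : ℤ) z m = m → m = 0) := by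
  have hp : p.Prime := Fact.out
  obtain ⟨z, a, -, ha1, hz⟩ := h.kolyvaginImage_scalar_pow_of_heegner hK hHN hHp hM
  refine ⟨z, a, fun m ↦ by rw [WeierstrassCurve.torsionGaloisModule_apply_apply, hz m],
    fun m hm ↦ ?_⟩
  rw [WeierstrassCurve.torsionGaloisModule_apply_apply, hz m] at hm
  exact eq_zero_of_smul_eq_of_prime_pow hp M (AddSubgroup.torsionBy.nsmul m) ha1 hm

end X9

end Literature.NumberTheory.EllipticCurves.Rank1Residual

end
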